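import Literature.Analysis.UnboundedOperators.LinearMildFlow
import HarnessLib

/-!
# Invertibility of `1 + P` for the linearised Volterra operator `(P w)(t) = ∫₀ᵗ K(t − s) B(s) w(s) ds`

Analysis/UnboundedOperators support file (theorems only, everything proved, no named facts, no
definitions).  Let `E` be a real Banach space, `K(t)` (`t > 0`) bounded operators with the weakly
singular bound `‖K(t)‖ ≤ C t^{-α}`, `0 ≤ α < 1` (the abstract `A^α e^{-tA}` of D. Henry, *Geometric Theory
of Semilinear Parabolic Equations*, LNM 840 (1981), Thm 1.4.3), `τ > 0`, and `B : ℝ → L(E)` a bounded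
coefficient family, `‖B(s)‖ ≤ β`.  If `P` is a bounded operator on `X = C([0, τ]; E)` acting as the
linear Volterra (Duhamel) operator

  `(P w)(t) = ∫₀ᵗ K(t − s) B(s) w(s) ds`     (`0 ≤ t ≤ τ`),

then **`1 + P` is invertible on `X`** (`isInvertible_one_add_of_eq_duhamel`): the linear Volterra
equation of the second kind `w + P w = g` has, for every continuous `g`, a unique continuous solution
depending continuously on `g`.  Classically this is the Picard (Neumann) series summed with the help of
the singular Grönwall lemma (Henry 1981, Lemma 7.1.1, Thm 7.1.3: the evolution operators of
`w' + A w + A^α B(t) w = g`).  Here, as in the sibling `LinearMildFlow.lean`, the **exponential weight**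
does it softly: with the mutually inverse multiplication operators `(J_∓ w)(t) = e^{∓γt} w(t)`
(`exists_expWeightCLM`) one has `J₋ P J₊ = P_γ`, the Volterra operator of the weighted kernel
`K_γ(t) = e^{-γt} K(t)` (`integral_duhamel_exp_weight`), and `‖K_γ(t)‖ ≤ C γ^{-p} t^{-(α + p)}`,
`p = (1 − α)/2` (`norm_exp_smul_le`), so `‖P_γ‖ ≤ 1/2` for `γ` large (`norm_integral_duhamel_le_of_mem_Icc`);
then `1 + P_γ` is inverted by the Neumann series (`exists_inverse_one_add_of_norm_le`) and
`1 + P = J₊ (1 + P_γ) J₋`.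

This is the non-degeneracy hypothesis of the implicit function theorem in the proof that the mild
solution of `y' + Ay + N(y, y) = f` depends smoothly on `y(0)` as a curve in `C([0, τ]; E)` (Henry 1981,
Thm 3.4.4: `P = ∂_w [Φ N(w, w)]` at the solution, `B(s) = N(y(s), ·) + N(·, y(s))`), for which see
`MildFlowDerivativesCurve.lean`.

## References

* D. Henry, *Geometric Theory of Semilinear Parabolic Equations*, LNM 840, Springer (1981), Thm 1.4.3,
  Thm 3.4.4, §7.1 (Lemma 7.1.1, Thm 7.1.3). [Henry1981]
* A. Pazy, *Semigroups of Linear Operators and Applications to Partial Differential Equations*,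
  Springer (1983), §5.6, §6.3 Thm 6.3.1. [Pazy1983]
-/

noncomputable section

open MeasureTheory Set Filter intervalIntegral
open _root_.Topology

namespace Literature.Analysis.UnboundedOperators

variable {E : Type*} [NormedAddCommGroup E] [NormedSpace ℝ E]

/-- **The exponential weights on `C([0, τ]; E)`**: the multiplication operators
`(J₋ w)(t) = e^{-γt} w(t)` and `(J₊ w)(t) = e^{γt} w(t)` are bounded and mutually inverse (the change to
the equivalent weighted sup norm `sup_t e^{-γt} ‖w(t)‖` of the Volterra / singular Grönwall theory,
Henry 1981, §7.1, written as a conjugation). [folklore] -/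
theorem exists_expWeightCLM (τ γ : ℝ) :
    ∃ Jn Jp : C(Icc (0 : ℝ) τ, E) →L[ℝ] C(Icc (0 : ℝ) τ, E),
      (∀ (w : C(Icc (0 : ℝ) τ, E)) (t : Icc (0 : ℝ) τ), Jn w t = Real.exp (-(γ * t)) • w t) ∧
      (∀ (w : C(Icc (0 : ℝ) τ, E)) (t : Icc (0 : ℝ) τ), Jp w t = Real.exp (γ * t) • w t) ∧
      Jn * Jp = 1 ∧ Jp * Jn = 1 := by
  obtain ⟨M, hM, -⟩ := exists_mulCLM (E := E) (Icc (0 : ℝ) τ)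
  have hcn : Continuous fun t : Icc (0 : ℝ) τ => Real.exp (-(γ * t)) • (1 : E →L[ℝ] E) :=
    (Real.continuous_exp.comp (continuous_const.mul continuous_subtype_val).neg).smul continuous_const
  have hcp : Continuous fun t : Icc (0 : ℝ) τ => Real.exp (γ * t) • (1 : E →L[ℝ] E) :=
    (Real.continuous_exp.comp (continuous_const.mul continuous_subtype_val)).smul continuous_const
  set en : C(Icc (0 : ℝ) τ, E →L[ℝ] E) := ⟨_, hcn⟩ with hen
  set ep : C(Icc (0 : ℝ) τ, E →L[ℝ] E) := ⟨_, hcp⟩ with hep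
  have hJn : ∀ (w : C(Icc (0 : ℝ) τ, E)) (t : Icc (0 : ℝ) τ), M en w t = Real.exp (-(γ * t)) • w t :=
    fun w t => by rw [hM]; rfl
  have hJp : ∀ (w : C(Icc (0 : ℝ) τ, E)) (t : Icc (0 : ℝ) τ), M ep w t = Real.exp (γ * t) • w t :=
    fun w t => by rw [hM]; rfl
  refine ⟨M en, M ep, hJn, hJp, ?_, ?_⟩
  · ext w t
    rw [mul_apply_eq_comp, one_apply_eq_self, hJn, hJp, smul_smul,
      ← Real.exp_add, neg_add_cancel, Real.exp_zero, one_smul]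
  · ext w t
    rw [mul_apply_eq_comp, one_apply_eq_self, hJp, hJn, smul_smul,
      ← Real.exp_add, add_neg_cancel, Real.exp_zero, one_smul]

/-- **`1 + P` is invertible for the weakly singular linear Volterra operator
`(P w)(t) = ∫₀ᵗ K(t − s) B(s) w(s) ds` on `C([0, τ]; E)`** (Henry 1981, §7.1, Lemma 7.1.1 / Thm 7.1.3 in
resolvent form).  Let `E` be a real Banach space, `‖K(t)‖ ≤ C t^{-α}` for `t > 0` (`C ≥ 0`, `0 ≤ α < 1`),
`‖B(s)‖ ≤ β`, `τ > 0`, and let the bounded operator `P` of `C([0, τ]; E)` satisfy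
`(P w)(t) = ∫₀ᵗ K(t − s) B(s) w(s) ds` (the curve read on `ℝ` through `Set.projIcc`).  Then `1 + P` is
invertible: conjugating by the exponential weight `e^{-γt}` turns `P` into the Volterra operator of the
kernel `e^{-γt} K(t)`, of norm `≤ 1/2` for `γ` large, and the Neumann series applies.
[cite: Henry1981, Lemma 7.1.1 and Thm 7.1.3] -/
theorem isInvertible_one_add_of_eq_duhamel [CompleteSpace E] {τ α C β : ℝ} (hτ : 0 < τ) (hα₀ : 0 ≤ α)
    (hα : α < 1) (hC : 0 ≤ C) {K : ℝ → E →L[ℝ] E} (hK : ∀ t, 0 < t → ‖K t‖ ≤ C * t ^ (-α))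
    {B : ℝ → E →L[ℝ] E} (hB : ∀ s, ‖B s‖ ≤ β) {P : C(Icc (0 : ℝ) τ, E) →L[ℝ] C(Icc (0 : ℝ) τ, E)}
    (hP : ∀ (w : C(Icc (0 : ℝ) τ, E)) (t : Icc (0 : ℝ) τ),
      P w t = ∫ s in (0 : ℝ)..(t : ℝ), K ((t : ℝ) - s) (B s (w (Set.projIcc 0 τ hτ.le s)))) :
    (1 + P).IsInvertible := by
  have hβ : 0 ≤ β := (norm_nonneg _).trans (hB 0)
  -- ### the exponents `p`, `α + p` and the weight rate `γ`
  have hα1 : 0 < 1 - α := by linarith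
  set p : ℝ := (1 - α) / 2 with hp
  have hp0 : 0 < p := by positivity
  have hp1 : p ≤ 1 := by rw [hp]; linarith
  have hα'1 : α + p < 1 := by rw [hp]; linarith
  obtain ⟨x, hx0, -, hx⟩ := exists_pos_le_mul_rpow_le (β := p)
    (M := C * τ ^ (1 - (α + p)) / (1 - (α + p)) * β) (ε := 1 / 2) (b := 1) hp0 one_half_pos one_pos
  set γ : ℝ := x⁻¹ with hγ
  have hγ0 : 0 < γ := inv_pos.2 hx0
  have hγp : γ ^ (-p) = x ^ p := by
    rw [hγ, Real.rpow_neg (inv_pos.2 hx0).le, Real.inv_rpow hx0.le, inv_inv]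
  have hC'0 : 0 ≤ C * γ ^ (-p) := mul_nonneg hC (Real.rpow_nonneg hγ0.le _)
  have hsmall : C * γ ^ (-p) * τ ^ (1 - (α + p)) / (1 - (α + p)) * β ≤ 1 / 2 := by
    calc C * γ ^ (-p) * τ ^ (1 - (α + p)) / (1 - (α + p)) * β
        = C * τ ^ (1 - (α + p)) / (1 - (α + p)) * β * x ^ p := by rw [hγp]; ring
      _ ≤ 1 / 2 := hx
  have hKγb : ∀ t, 0 < t → ‖Real.exp (-(γ * t)) • K t‖ ≤ C * γ ^ (-p) * t ^ (-(α + p)) :=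
    fun t ht => norm_exp_smul_le hC hK hγ0 hp0.le hp1 ht
  -- ### the weights and the conjugated (small) Volterra operator
  obtain ⟨Jn, Jp, hJn, hJp, hJ1, hJ2⟩ := exists_expWeightCLM (E := E) τ γ
  have hJ1' : ∀ X : C(Icc (0 : ℝ) τ, E) →L[ℝ] C(Icc (0 : ℝ) τ, E), Jn * (Jp * X) = X := fun X => by
    rw [← mul_assoc, hJ1, one_mul]
  have hJ2' : ∀ X : C(Icc (0 : ℝ) τ, E) →L[ℝ] C(Icc (0 : ℝ) τ, E), Jp * (Jn * X) = X := fun X => by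
    rw [← mul_assoc, hJ2, one_mul]
  set Pγ : C(Icc (0 : ℝ) τ, E) →L[ℝ] C(Icc (0 : ℝ) τ, E) := Jn * P * Jp with hPγ
  have hPγap : ∀ (w : C(Icc (0 : ℝ) τ, E)) (t : Icc (0 : ℝ) τ), Pγ w t =
      ∫ s in (0 : ℝ)..(t : ℝ), (Real.exp (-(γ * ((t : ℝ) - s))) • K ((t : ℝ) - s))
        (B s (w (Set.projIcc 0 τ hτ.le s))) := by
    intro w t
    rw [hPγ, mul_apply_eq_comp, mul_apply_eq_comp, hJn, hP,
      ← integral_duhamel_exp_weight K B (fun s => Jp w (Set.projIcc 0 τ hτ.le s)) γ t]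
    refine intervalIntegral.integral_congr fun s hs => ?_
    rw [uIcc_of_le t.2.1] at hs
    rw [hJp, Set.projIcc_of_mem hτ.le ⟨hs.1, hs.2.trans t.2.2⟩, smul_smul, ← Real.exp_add,
      neg_add_cancel, Real.exp_zero, one_smul]
  have hPγn : ‖Pγ‖ ≤ 1 / 2 := by
    refine ContinuousLinearMap.opNorm_le_bound _ (by norm_num) fun w => ?_
    refine (ContinuousMap.norm_le _ (by positivity)).2 fun t => ?_
    rw [hPγap]
    have hg : ∀ s, ‖B s (w (Set.projIcc 0 τ hτ.le s))‖ ≤ β * ‖w‖ := fun s =>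
      calc ‖B s (w (Set.projIcc 0 τ hτ.le s))‖ ≤ ‖B s‖ * ‖w (Set.projIcc 0 τ hτ.le s)‖ :=
            (B s).le_opNorm _
        _ ≤ β * ‖w‖ := mul_le_mul (hB s) (w.norm_coe_le_norm _) (norm_nonneg _) hβ
    calc ‖∫ s in (0 : ℝ)..(t : ℝ), (Real.exp (-(γ * ((t : ℝ) - s))) • K ((t : ℝ) - s))
          (B s (w (Set.projIcc 0 τ hτ.le s)))‖
        ≤ C * γ ^ (-p) * τ ^ (1 - (α + p)) / (1 - (α + p)) * (β * ‖w‖) :=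
          norm_integral_duhamel_le_of_mem_Icc (K := fun u => Real.exp (-(γ * u)) • K u) hKγb hC'0 hα'1
            (fun s => B s (w (Set.projIcc 0 τ hτ.le s))) hg t.2
      _ = C * γ ^ (-p) * τ ^ (1 - (α + p)) / (1 - (α + p)) * β * ‖w‖ := by ring
      _ ≤ 1 / 2 * ‖w‖ := mul_le_mul_of_nonneg_right hsmall (norm_nonneg w)
  -- ### Neumann series for `1 + P_γ`, and the conjugation `1 + P = J₊ (1 + P_γ) J₋`
  obtain ⟨R, hR1, hR2, -⟩ := exists_inverse_one_add_of_norm_le Pγ hPγn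
  have hconj : 1 + P = Jp * (1 + Pγ) * Jn := by
    simp only [hPγ, mul_add, add_mul, mul_one, mul_assoc, hJ2', hJ2]
  set S : C(Icc (0 : ℝ) τ, E) →L[ℝ] C(Icc (0 : ℝ) τ, E) := Jp * R * Jn with hS
  have h1 : (1 + P) * S = 1 := by
    rw [hconj]
    simp only [hS, mul_assoc, hJ1']
    rw [← mul_assoc (1 + Pγ), hR2, one_mul, hJ2]
  have h2 : S * (1 + P) = 1 := by
    rw [hconj]
    simp only [hS, mul_assoc, hJ1']
    rw [← mul_assoc R, hR1, one_mul, hJ2]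
  refine ContinuousLinearMap.IsInvertible.of_inverse (g := S) ?_ ?_
  · rw [← ContinuousLinearMap.mul_def, ← ContinuousLinearMap.one_def]
    exact h1
  · rw [← ContinuousLinearMap.mul_def, ← ContinuousLinearMap.one_def]
    exact h2

end Literature.Analysis.UnboundedOperators

end
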